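import Mathlib
import Summits.ValiantsHypothesis.ValiantsHypothesis.Theorems.RigidityForcesSymmetryRankRigidMinimalReprLaplaceFiveSectorSplitDefs
import Summits.ValiantsHypothesis.ValiantsHypothesis.Theorems.RigidityForcesSymmetryRankRigidMinimalReprLaplaceFiveSymmetricPieces
import Summits.ValiantsHypothesis.ValiantsHypothesis.Theorems.RigidityForcesSymmetryRankRigidMinimalReprLaplaceFiveTriangleNoSideSym
import Summits.ValiantsHypothesis.ValiantsHypothesis.Theorems.RigidityForcesSymmetryRankRigidMinimalReprLaplaceFiveSlackCoherence

/-!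
# ValiantsHypothesis / RigidityForcesSymmetry — crux `LaplaceOptimalFive` (stmt-ValiantsHypothesis-24813), crux idea
`young-shadow` (K1) ON THE STAR `K₁,₄`: **ONE SYMMETRIC SHADOW SUFFICES**

On the star support (all pair splits through one slot) the exchange lemma makes every Young shadow conjugate to every other one
modulo fully symmetric tensors (✓ `LaplaceFiveSectorSplit.exchange`, `star_coherence`).  Hence if ONE shadow of a side-symmetric
pair decomposition of `P₅` supported on a star is fully slot-symmetric, ALL shadows are, and the catalecticant step
✓ `LaplaceFiveSymmetricPieces.symmetricPieces_needTen` gives at least ten terms, weight `≥ 120`.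

This is the `E = 0` branch of the K1-on-the-star argument (memo `pub/val-lit/lmr/NOTE-p4g15-24813-K1-star.md`, §2–§3): in the
cubic-matrix currency every shadow is `Hess f_j + E` with one common slack `E` of Schur type `(3,2)`, and a shadow is fully symmetric
iff `E = 0`.

Honest framing.  K1 on the star in general (`sideSym_starPairSplits`), K1 on `C₄` / `K₃ ⊔ K₂` / `≥ 5` splits, S2′, `LaplaceOptimalFive`
(OPEN · CONTESTED 72/120), `RankRigidMinimalRepr`, `VP ≠ VNP` are NOT proved.  No definitions, no `sorry`; Mathlib + tree only.
-/

set_option linter.dupNamespace false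

namespace Summit.ValiantsHypothesis.ValiantsHypothesis.Theorems.RigidityForcesSymmetryRankRigidMinimalRepr

namespace LaplaceFiveStar

open Finset LaplaceFiveSectorSplit

/-- A fully symmetric tensor stays fully symmetric after a slot permutation. [folklore] -/
theorem univ_comp {Z : (Fin 5 → Fin 5) → ℂ} (h : SlotInvariantOn Finset.univ Z) (σ : Equiv.Perm (Fin 5)) :
    SlotInvariantOn Finset.univ (fun v => Z (v ∘ ⇑σ)) := by
  have h1 := slotInvariantOn_comp σ h
  rwa [Finset.image_univ_equiv] at h1

/-- **Star transfer of full symmetry.**  Shadows `Z A` (`A` ranging over a family `I` of pair splits through a common slot `c`),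
each symmetric within both sides of its split, with fully symmetric sum: if one of them is fully symmetric then all are. [folklore] -/
theorem star_all_symmetric (I : Finset (Finset (Fin 5))) (hI : ∀ A ∈ I, A.card = 2) (c : Fin 5) (hc : ∀ A ∈ I, c ∈ A)
    (Z : Finset (Fin 5) → (Fin 5 → Fin 5) → ℂ)
    (hside : ∀ A ∈ I, SlotInvariantOn A (Z A) ∧ SlotInvariantOn Aᶜ (Z A))
    (hsum : SlotInvariantOn Finset.univ (fun v => ∑ A ∈ I, Z A v))
    (A₀ : Finset (Fin 5)) (hA₀ : A₀ ∈ I) (hZ₀ : SlotInvariantOn Finset.univ (Z A₀)) :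
    ∀ B ∈ I, SlotInvariantOn Finset.univ (Z B) := by
  classical
  intro B hB
  by_cases hBA : B = A₀
  · rw [hBA]; exact hZ₀
  -- write `A₀ = {c, a}`, `B = {c, b}`
  obtain ⟨a, hca, hA₀e⟩ : ∃ a : Fin 5, c ≠ a ∧ A₀ = {c, a} := by
    obtain ⟨x, y, hxy, hxy'⟩ := Finset.card_eq_two.mp (hI A₀ hA₀)
    have hcm := hc A₀ hA₀
    rw [hxy'] at hcm
    simp only [Finset.mem_insert, Finset.mem_singleton] at hcm
    rcases hcm with rfl | rfl
    · exact ⟨y, hxy, hxy'⟩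
    · exact ⟨x, fun h => hxy (h ▸ rfl), by rw [hxy', Finset.pair_comm]⟩
  obtain ⟨b, hcb, hBe⟩ : ∃ b : Fin 5, c ≠ b ∧ B = {c, b} := by
    obtain ⟨x, y, hxy, hxy'⟩ := Finset.card_eq_two.mp (hI B hB)
    have hcm := hc B hB
    rw [hxy'] at hcm
    simp only [Finset.mem_insert, Finset.mem_singleton] at hcm
    rcases hcm with rfl | rfl
    · exact ⟨y, hxy, hxy'⟩
    · exact ⟨x, fun h => hxy (h ▸ rfl), by rw [hxy', Finset.pair_comm]⟩
  have hab : a ≠ b := fun h => hBA (by rw [hBe, hA₀e, h])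
  -- the remaining shadows are invariant under `(a b)`
  set R : (Fin 5 → Fin 5) → ℂ := fun v => ∑ A ∈ (I.erase A₀).erase B, Z A v with hR
  have hRinv : InvUnder (Equiv.swap a b) R := by
    intro v
    show (∑ A ∈ (I.erase A₀).erase B, Z A (v ∘ ⇑(Equiv.swap a b))) = ∑ A ∈ (I.erase A₀).erase B, Z A v
    refine Finset.sum_congr rfl fun A hA => ?_
    have hA1 : A ≠ B := Finset.ne_of_mem_erase hA
    have hA2 : A ∈ I.erase A₀ := Finset.mem_of_mem_erase hA
    have hA3 : A ≠ A₀ := Finset.ne_of_mem_erase hA2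
    have hAI : A ∈ I := Finset.mem_of_mem_erase hA2
    have hcA := hc A hAI
    -- `a ∉ A` and `b ∉ A`
    have key : ∀ x : Fin 5, c ≠ x → A ≠ ({c, x} : Finset (Fin 5)) → x ∉ A := by
      intro x hcx hAx hxA
      apply hAx
      symm
      apply Finset.eq_of_subset_of_card_le
      · intro y hy
        simp only [Finset.mem_insert, Finset.mem_singleton] at hy
        rcases hy with rfl | rfl
        · exact hcA
        · exact hxA
      · rw [hI A hAI, Finset.card_pair hcx]
    have haA : a ∉ A := key a hca (hA₀e ▸ hA3)
    have hbA : b ∉ A := key b hcb (hBe ▸ hA1)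
    exact invUnder_swap_of_not_mem (hside A hAI).2 haA hbA v
  -- the full sum regrouped
  have hsum' : SlotInvariantOn Finset.univ (Z A₀ + Z B + R) := by
    have e : Z A₀ + Z B + R = fun v => ∑ A ∈ I, Z A v := by
      funext v
      simp only [Pi.add_apply, hR]
      have h1 := Finset.add_sum_erase I (fun A => Z A v) hA₀
      have h2 := Finset.add_sum_erase (I.erase A₀) (fun A => Z A v) (Finset.mem_erase.mpr ⟨hBA, hB⟩)
      rw [← h1, ← h2]
      ring
    rw [e]; exact hsum
  have hex := exchange (S₁ := A₀) (S₂ := B) (hI A₀ hA₀) (hI B hB) (Ne.symm hBA) (Equiv.swap a b)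
    (by rw [hA₀e, hBe]; exact image_pair_swap c a b hca hcb)
    (by rw [hA₀e, hBe, Equiv.swap_comm]; exact image_pair_swap c b a hcb hca)
    (hside A₀ hA₀) (hside B hB) hRinv hsum'
  -- `Z B = (Z B − (ab)•Z A₀) + (ab)•Z A₀`, both fully symmetric
  have e : Z B = (Z B - fun v => Z A₀ (v ∘ ⇑(Equiv.swap a b))) + fun v => Z A₀ (v ∘ ⇑(Equiv.swap a b)) := by
    funext v; simp
  rw [e]
  exact slotInvariantOn_add hex (univ_comp hZ₀ _)

/-- **K1 on the star, `E = 0` branch: one fully symmetric shadow suffices.**  A side-symmetric pair decomposition of `P₅` whose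
splits all pass through one slot, ONE of whose Young shadows is fully slot-symmetric, weighs `≥ 120`. [folklore] -/
theorem sideSym_star_of_symmetric_shadow (N : ℕ) (T : Finset (Fin N)) (S : Fin N → Finset (Fin 5))
    (u w : Fin N → (Fin 5 → Fin 5) → ℂ) (hdec : IsSplitDecomposition T S u w) (hsym : SideSymmetric T S u w)
    (hpair : ∀ t ∈ T, (S t).card = 2) (hstar : ∃ c : Fin 5, ∀ A ∈ T.image S, c ∈ A)
    (A₀ : Finset (Fin 5)) (hA₀ : A₀ ∈ T.image S)
    (hZ₀ : SlotInvariantOn Finset.univ (fun v => ∑ t ∈ T.filter (fun t => S t = A₀), u t v * w t v)) :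
    Nat.factorial 5 ≤ laplaceWeight T S := by
  classical
  obtain ⟨hu, hw, hid⟩ := hdec
  obtain ⟨c, hc⟩ := hstar
  set Z : Finset (Fin 5) → (Fin 5 → Fin 5) → ℂ := fun A v => ∑ t ∈ T.filter (fun t => S t = A), u t v * w t v with hZ
  have hside : ∀ A ∈ T.image S, SlotInvariantOn A (Z A) ∧ SlotInvariantOn Aᶜ (Z A) := fun A _ =>
    ⟨fun τ hτ v => LaplaceFiveTriangleSeparation.shadow_inv_left T S u w hw hsym A τ hτ v,
      fun τ hτ v => LaplaceFiveTriangleSeparation.shadow_inv_right T S u w hu hsym A τ hτ v⟩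
  have hfib : ∀ v : Fin 5 → Fin 5, ∑ A ∈ T.image S, Z A v = if Function.Injective v then 1 else 0 := by
    intro v
    simp only [hZ]
    rw [Finset.sum_fiberwise_of_maps_to (g := S) (fun t (ht : t ∈ T) => Finset.mem_image_of_mem S ht)]
    exact hid v
  have hsum : SlotInvariantOn Finset.univ (fun v => ∑ A ∈ T.image S, Z A v) := by
    intro τ _ v
    show (∑ A ∈ T.image S, Z A (v ∘ ⇑τ)) = ∑ A ∈ T.image S, Z A v
    rw [hfib, hfib, if_congr (Equiv.injective_comp τ v) rfl rfl]
  have hall := star_all_symmetric (T.image S)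
    (fun A hA => by obtain ⟨t, ht, rfl⟩ := Finset.mem_image.mp hA; exact hpair t ht)
    c hc Z hside hsum A₀ hA₀ hZ₀
  have hsymm : ∀ A : Finset (Fin 5), SlotInvariantOn Finset.univ (Z A) := by
    intro A
    by_cases hA : A ∈ T.image S
    · exact hall A hA
    · have hempty : T.filter (fun t => S t = A) = ∅ := by
        refine Finset.filter_eq_empty_iff.mpr fun t ht h => hA ?_
        rw [← h]; exact Finset.mem_image_of_mem S ht
      intro τ _ v
      simp only [hZ, hempty, Finset.sum_empty]
  have hten := LaplaceFiveSymmetricPieces.symmetricPieces_needTen N T S u w ⟨hu, hw, hid⟩ hpair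
    (fun A τ hτ v => hsymm A τ hτ v)
  have hwt : laplaceWeight T S = ∑ t ∈ T, 12 := by
    refine Finset.sum_congr rfl fun t ht => ?_
    rw [hpair t ht]; decide
  rw [hwt, Finset.sum_const, smul_eq_mul]
  show 120 ≤ T.card * 12
  omega

end LaplaceFiveStar

end Summit.ValiantsHypothesis.ValiantsHypothesis.Theorems.RigidityForcesSymmetryRankRigidMinimalRepr
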